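import Summits.QuantumFields.YangMills.Theorems.IsotropyFromPowerCountingTemperedCurvatureMomentsDegreeTwo
import Literature.Analysis.FunctionSpaces.WightmanFunctions

/-!
# Three-slot regularity, Part 1: calculus of `n`-fold tensors with one slot replaced

Support file for stub `stub_threeSlotRegularity` (C) of reshape 4 of
`Cruxes/TemperedCurvatureMoments/Lines/Sketch.lean` (crux stmt-QuantumFields-17721, line `Sketch`).
Elementary calculus of the tensors `SchwartzMap.tensorFin n (Function.update f k g)` (the `n`-slot
analogue of the two-slot lemmas of `…PencilRigidityCurvatureKernelBoundChartDerivativeBoundsTensor.lean`):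

* `tensorFin_update_apply`, `tensorFin_update_add`, `tensorFin_update_smul`: linearity in slot `k`;
* `hasFDerivAt_tensorFin`, `lineDerivOp_tensorFin`: the Leibniz rule
  `∂_U (⊗ᵢ fᵢ) = Σᵢ f₀ ⊗ ⋯ ⊗ ∂_{Uᵢ} fᵢ ⊗ ⋯ ⊗ f_{n-1}`;
* `lineDerivOp_single_tensorFin`, `iterate_lineDerivOp_single_tensorFin`: directions in slot `k` fall on
  factor `k`;
* `tsupport_tensorFin_subset`, `isOffDiagonal_of_tsupport_subset_balls`: supports, and tensors supported
  in a product of pairwise disjoint balls lie in `⁰𝒮`;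
* `apply_lineDerivOp_const_eq_zero`: a functional that is translation invariant on `⁰𝒮` kills the
  diagonal derivative `∂_{(u,…,u)} F` of every `F` supported off the coincidence locus
  (`hasDerivAt_apply_compSubConstCLM_smul`: the translation orbit is differentiable and constant).
[folklore]
-/

noncomputable section

namespace Summit.QuantumFields.YangMills.Theorems.TemperedCurvatureMoments.Sketch

namespace ThreeSlotRegularity

open scoped BigOperators SchwartzMap LineDeriv
open MeasureTheory Filter Topology Set
open Literature.MathematicalPhysics.QuantumFieldTheory Literature.MathematicalPhysics.QuantumLattice
open Literature.MathematicalPhysics.AQFT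
open Summit.QuantumFields.YangMills.Theorems.CurvatureKernel (hasDerivAt_apply_compSubConstCLM_smul)

variable {E : Type*} [NormedAddCommGroup E] [NormedSpace ℝ E] {n : ℕ}

/-! ## Linearity in one slot -/

/-- `(⊗ update f k g)(x) = g(x_k) ∏_{i ≠ k} fᵢ(xᵢ)`. [folklore] -/
theorem tensorFin_update_apply (f : Fin n → 𝓢(E, ℂ)) (k : Fin n) (g : 𝓢(E, ℂ)) (x : Fin n → E) :
    SchwartzMap.tensorFin n (Function.update f k g) x = g (x k) * ∏ i ∈ Finset.univ.erase k, f i (x i) := by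
  rw [SchwartzMap.tensorFin_apply]
  have h : (fun i => Function.update f k g i (x i)) = Function.update (fun i => f i (x i)) k (g (x k)) := by
    funext i
    by_cases hi : i = k
    · subst hi
      simp
    · simp [Function.update_of_ne hi]
  rw [h, Finset.prod_update_of_mem (Finset.mem_univ k), Finset.sdiff_singleton_eq_erase]

/-- `(⊗ f)(x) = f_k(x_k) ∏_{i ≠ k} fᵢ(xᵢ)`. [folklore] -/
theorem tensorFin_apply_eq_mul_prod_erase (f : Fin n → 𝓢(E, ℂ)) (k : Fin n) (x : Fin n → E) :
    SchwartzMap.tensorFin n f x = f k (x k) * ∏ i ∈ Finset.univ.erase k, f i (x i) := by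
  conv_lhs => rw [← Function.update_eq_self k f]
  exact tensorFin_update_apply f k (f k) x

/-- Additivity of `⊗ update f k g` in `g`. [folklore] -/
theorem tensorFin_update_add (f : Fin n → 𝓢(E, ℂ)) (k : Fin n) (g₁ g₂ : 𝓢(E, ℂ)) :
    SchwartzMap.tensorFin n (Function.update f k (g₁ + g₂)) =
      SchwartzMap.tensorFin n (Function.update f k g₁) + SchwartzMap.tensorFin n (Function.update f k g₂) := by
  ext x
  simp only [tensorFin_update_apply, add_apply]
  ring

/-- Homogeneity of `⊗ update f k g` in `g`. [folklore] -/
theorem tensorFin_update_smul (f : Fin n → 𝓢(E, ℂ)) (k : Fin n) (c : ℂ) (g : 𝓢(E, ℂ)) :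
    SchwartzMap.tensorFin n (Function.update f k (c • g)) = c • SchwartzMap.tensorFin n (Function.update f k g) := by
  ext x
  simp only [tensorFin_update_apply, smul_apply, smul_eq_mul]
  ring

/-- Zero in slot `k`. [folklore] -/
theorem tensorFin_update_zero (f : Fin n → 𝓢(E, ℂ)) (k : Fin n) :
    SchwartzMap.tensorFin n (Function.update f k 0) = 0 := by
  ext x
  simp only [tensorFin_update_apply, zero_apply, zero_mul]

/-! ## The Leibniz rule -/

/-- The derivative of `⊗ᵢ fᵢ` at `x`: `Σᵢ (∏_{j ≠ i} fⱼ(xⱼ)) Dfᵢ(xᵢ) ∘ prᵢ`. [folklore] -/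
theorem hasFDerivAt_tensorFin (f : Fin n → 𝓢(E, ℂ)) (x : Fin n → E) :
    HasFDerivAt (SchwartzMap.tensorFin n f : (Fin n → E) → ℂ)
      (∑ i, (∏ j ∈ Finset.univ.erase i, f j (x j)) •
        ((fderiv ℝ (f i) (x i)).comp (ContinuousLinearMap.proj (R := ℝ) i))) x := by
  have hfun : (SchwartzMap.tensorFin n f : (Fin n → E) → ℂ) = fun x => ∏ i, f i (x i) :=
    funext (SchwartzMap.tensorFin_apply f)
  rw [hfun]
  have h : ∀ i ∈ (Finset.univ : Finset (Fin n)), HasFDerivAt (fun x : Fin n → E => f i (x i))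
      ((fderiv ℝ (f i) (x i)).comp (ContinuousLinearMap.proj (R := ℝ) i)) x := fun i _ =>
    ((f i).hasFDerivAt (x i)).comp x (ContinuousLinearMap.proj (R := ℝ) i : (Fin n → E) →L[ℝ] E).hasFDerivAt
  exact HasFDerivAt.finsetProd h

/-- **Leibniz rule**: `∂_U (⊗ᵢ fᵢ) = Σᵢ ⊗ (update f i (∂_{Uᵢ} fᵢ))`. [folklore] -/
theorem lineDerivOp_tensorFin (U : Fin n → E) (f : Fin n → 𝓢(E, ℂ)) :
    (∂_{U} (SchwartzMap.tensorFin n f) : 𝓢((Fin n → E), ℂ)) =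
      ∑ i, SchwartzMap.tensorFin n (Function.update f i (∂_{U i} (f i))) := by
  ext x
  rw [SchwartzMap.lineDerivOp_apply_eq_fderiv, (hasFDerivAt_tensorFin f x).fderiv]
  simp only [FunLike.coe_sum, Finset.sum_apply, FunLike.coe_smul, Pi.smul_apply,
    ContinuousLinearMap.coe_comp, Function.comp_apply, ContinuousLinearMap.proj_apply, smul_eq_mul,
    tensorFin_update_apply, SchwartzMap.lineDerivOp_apply_eq_fderiv]
  exact Finset.sum_congr rfl fun i _ => mul_comm _ _

/-- **Directions in slot `k` fall on factor `k`**: `∂_{(0,…,v,…,0)} (⊗ f) = ⊗ (update f k (∂_v f_k))`. [folklore] -/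
theorem lineDerivOp_single_tensorFin (k : Fin n) (v : E) (f : Fin n → 𝓢(E, ℂ)) :
    (∂_{(Pi.single k v : Fin n → E)} (SchwartzMap.tensorFin n f) : 𝓢((Fin n → E), ℂ)) =
      SchwartzMap.tensorFin n (Function.update f k (∂_{v} (f k))) := by
  rw [lineDerivOp_tensorFin, Finset.sum_eq_single k]
  · rw [Pi.single_eq_same]
  · intro i _ hi
    rw [Pi.single_eq_of_ne hi, LineDeriv.lineDerivOp_left_zero, tensorFin_update_zero]
  · exact fun h => absurd (Finset.mem_univ k) h

/-- Iterated form: `(∂_{(0,…,v,…,0)})^[j] (⊗ f) = ⊗ (update f k ((∂_v)^[j] f_k))`. [folklore] -/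
theorem iterate_lineDerivOp_single_tensorFin (k : Fin n) (v : E) (j : ℕ) (f : Fin n → 𝓢(E, ℂ)) :
    ((∂_{(Pi.single k v : Fin n → E)} : 𝓢((Fin n → E), ℂ) → 𝓢((Fin n → E), ℂ))^[j]
        (SchwartzMap.tensorFin n f)) =
      SchwartzMap.tensorFin n (Function.update f k (((∂_{v} : 𝓢(E, ℂ) → 𝓢(E, ℂ))^[j]) (f k))) := by
  induction j with
  | zero => simp
  | succ j ih =>
    rw [Function.iterate_succ_apply', ih, lineDerivOp_single_tensorFin, Function.update_idem,
      Function.update_self, Function.iterate_succ_apply']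

/-! ## Supports and `⁰𝒮` -/

/-- The support of `⊗ f` lies in the product of the supports. [folklore] -/
theorem tsupport_tensorFin_subset (f : Fin n → 𝓢(E, ℂ)) :
    tsupport (SchwartzMap.tensorFin n f : (Fin n → E) → ℂ) ⊆ {x | ∀ i, x i ∈ tsupport (f i : E → ℂ)} := by
  have hS : IsClosed {x : Fin n → E | ∀ i, x i ∈ tsupport (f i : E → ℂ)} := by
    have : {x : Fin n → E | ∀ i, x i ∈ tsupport (f i : E → ℂ)} = ⋂ i, (fun x : Fin n → E => x i) ⁻¹' tsupport (f i : E → ℂ) := by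
      ext x; simp
    rw [this]
    exact isClosed_iInter fun i => (isClosed_tsupport _).preimage (continuous_apply i)
  refine closure_minimal (fun x hx i => subset_tsupport _ ?_) hS
  rw [Function.mem_support] at hx ⊢
  rw [SchwartzMap.tensorFin_apply] at hx
  exact Finset.prod_ne_zero_iff.1 hx i (Finset.mem_univ i)

omit [NormedSpace ℝ E] in
/-- A product of `2ρ`-separated `ρ`-balls misses the coincidence locus. [folklore] -/
theorem balls_subset_compl_coincidenceLocus (x : Fin n → E) {ρ : ℝ}
    (hsep : ∀ i j, i ≠ j → 2 * ρ < dist (x i) (x j)) :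
    {y : Fin n → E | ∀ i, y i ∈ Metric.ball (x i) ρ} ⊆ (coincidenceLocus n E)ᶜ := by
  rintro y hy ⟨i, j, hij, hyij⟩
  have hi := Metric.mem_ball.1 (hy i)
  have hj := Metric.mem_ball.1 (hy j)
  have h := hsep i j hij
  have htri : dist (x i) (x j) ≤ dist (y i) (x i) + dist (y j) (x j) := by
    calc dist (x i) (x j) ≤ dist (x i) (y i) + dist (y i) (x j) := dist_triangle _ _ _
      _ = dist (y i) (x i) + dist (y j) (x j) := by rw [dist_comm (x i) (y i), hyij]
  linarith

/-- **Test functions supported in a product of `2ρ`-separated `ρ`-balls lie in `⁰𝒮`.** [folklore] -/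
theorem isOffDiagonal_of_tsupport_subset_balls {F : 𝓢((Fin n → E), ℂ)} (x : Fin n → E) {ρ : ℝ}
    (hsep : ∀ i j, i ≠ j → 2 * ρ < dist (x i) (x j))
    (hF : tsupport (F : (Fin n → E) → ℂ) ⊆ {y | ∀ i, y i ∈ Metric.ball (x i) ρ}) : IsOffDiagonal F :=
  IsOffDiagonal.of_tsupport_subset (hF.trans (balls_subset_compl_coincidenceLocus x hsep))

/-- Tensors with factors supported in `2ρ`-separated `ρ`-balls are supported in the product of the balls. [folklore] -/
theorem tsupport_tensorFin_subset_balls {f : Fin n → 𝓢(E, ℂ)} (x : Fin n → E) {ρ : ℝ}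
    (hf : ∀ i, tsupport (f i : E → ℂ) ⊆ Metric.ball (x i) ρ) :
    tsupport (SchwartzMap.tensorFin n f : (Fin n → E) → ℂ) ⊆ {y | ∀ i, y i ∈ Metric.ball (x i) ρ} :=
  (tsupport_tensorFin_subset f).trans fun _ hy i => hf i (hy i)

/-! ## Translation invariance kills diagonal derivatives -/

/-- The diagonal translation is `compSubConstCLM` at the constant vector. [folklore] -/
theorem translateMulti_eq_compSubConstCLM (a : E) :
    (translateMulti a : 𝓢((Fin n → E), ℂ) →L[ℂ] 𝓢((Fin n → E), ℂ)) =
      SchwartzMap.compSubConstCLM ℂ (fun _ : Fin n => a) := rfl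

/-- **A functional translation invariant on `⁰𝒮` kills diagonal derivatives**: if
`Λ(F(· − (a,…,a))) = Λ F` for all `F ∈ ⁰𝒮`, then `Λ (∂_{(u,…,u)} F) = 0` for every `F` supported off
the coincidence locus (differentiate the constant orbit `s ↦ Λ(F(· − s(u,…,u)))` at `s = 0`). [folklore] -/
theorem apply_lineDerivOp_const_eq_zero (Λ : 𝓢((Fin n → E), ℂ) →L[ℂ] ℂ)
    (hΛ : ∀ (a : E) (F : 𝓢((Fin n → E), ℂ)), IsOffDiagonal F → Λ (translateMulti a F) = Λ F)
    (u : E) {F : 𝓢((Fin n → E), ℂ)} (hF : tsupport (F : (Fin n → E) → ℂ) ⊆ (coincidenceLocus n E)ᶜ) :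
    Λ (∂_{(fun _ : Fin n => u)} F) = 0 := by
  have h1 := hasDerivAt_apply_compSubConstCLM_smul Λ F (fun _ : Fin n => u) 0
  rw [zero_smul, SchwartzMap.compSubConstCLM_zero, ContinuousLinearMap.id_apply] at h1
  have h2 : (fun s : ℝ => Λ (SchwartzMap.compSubConstCLM ℂ (s • (fun _ : Fin n => u)) F)) = fun _ => Λ F := by
    funext s
    have hs : (s • (fun _ : Fin n => u)) = fun _ : Fin n => s • u := rfl
    rw [hs, ← translateMulti_eq_compSubConstCLM]
    exact hΛ (s • u) F (IsOffDiagonal.of_tsupport_subset hF)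
  rw [h2] at h1
  have h3 := h1.unique (hasDerivAt_const (0 : ℝ) (Λ F))
  exact neg_eq_zero.1 h3

/-- Specialisation: `Λ (∂_{(u,…,u)} ⊗ f) = 0` when the factors live in `2ρ`-separated `ρ`-balls. [folklore] -/
theorem apply_lineDerivOp_const_tensorFin_eq_zero (Λ : 𝓢((Fin n → E), ℂ) →L[ℂ] ℂ)
    (hΛ : ∀ (a : E) (F : 𝓢((Fin n → E), ℂ)), IsOffDiagonal F → Λ (translateMulti a F) = Λ F)
    (x : Fin n → E) {ρ : ℝ} (hsep : ∀ i j, i ≠ j → 2 * ρ < dist (x i) (x j)) (u : E)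
    {f : Fin n → 𝓢(E, ℂ)} (hf : ∀ i, tsupport (f i : E → ℂ) ⊆ Metric.ball (x i) ρ) :
    Λ (∂_{(fun _ : Fin n => u)} (SchwartzMap.tensorFin n f)) = 0 :=
  apply_lineDerivOp_const_eq_zero Λ hΛ u
    ((tsupport_tensorFin_subset_balls x hf).trans (balls_subset_compl_coincidenceLocus x hsep))

end ThreeSlotRegularity

end Summit.QuantumFields.YangMills.Theorems.TemperedCurvatureMoments.Sketch
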